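import Mathlib.NumberTheory.LSeries.RiemannZeta
import Mathlib.Analysis.SpecialFunctions.Pow.Real
import HarnessLib

/-!
# RH-FREE — Yang's explicit bounds for `ζ` on the lines `σ_k = 1 − k/(2^k − 2)` and his explicit Littlewood zero-free region («nothing here bears on the truth of RH»)

Topic `Literature/NumberTheory/LFunctions` (RH literature-typing tranche 1, L4 "explicit zero
statistics": the explicit zero-free regions between the classical one (`5.558691`, Mossinghoff–
Trudgian–Yang 2024, tree: `zero_free_region_mossinghoff_trudgian_yang`) and the Korobov–Vinogradov
one (`55.241` MTY 2024, tree: `zero_free_region_vinogradov_korobov`; `53.989` Bellotti 2024, tree: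
`zero_free_region_bellotti`)). Label: **RH-FREE** — unconditional published theorems vendored as
NAMED FACTS (`def … : Prop`, D-0014; nothing asserted, users take `(h : …)`). Nothing here bears
on the truth of RH.

Source: A. Yang, *Explicit bounds on `ζ(s)` in the critical strip and a zero-free region*, J. Math.
Anal. Appl. **534** (2024) 128124 (arXiv:2301.03165v3, the January-2024 text; Zbl 1543.11077),
typed from the arXiv TeX source (Thm. 1.1 = `\label{theorem1}`, Cor. 1.2 = `\label{corollary1}`,
display (1.4)) — the PDF text loses the exponent in `2^k`, the TeX is authoritative:

* `zeta_bound_yang` — **Theorem 1.1**: for every integer `k ≥ 4`, with `σ_k := 1 − k/(2^k − 2)`,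
  `|ζ(σ_k + it)| ≤ 1.546 t^{1/(2^k − 2)} log t` for `t ≥ 3` (explicit Titchmarsh Thm. 5.13 via an
  explicit van der Corput `k`-th derivative test); e.g. `k = 4`: `|ζ(5/7 + it)| ≤ 1.546 t^{1/14} log t`
  (`zeta_bound_yang.five_sevenths`, proved);
* `zero_free_region_littlewood_yang` — **Corollary 1.2**: `ζ(σ + it) ≠ 0` for `|t| ≥ 3` and
  `σ > 1 − log log|t|/(21.233 log|t|)` (explicit Littlewood 1922 region; "the largest known
  zero-free region in the range `exp(170.3) ≤ t ≤ exp(532 141)`"; used by Bellotti 2024 for the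
  journal constant `53.989`);
* `zero_free_region_ford_hpy` — **display (1.4)**, the "intermediate" region: `ζ(σ + it) ≠ 0` for
  `|t| ≥ 3` and `σ > 1 − (0.04962 − 0.0196/(J(|t|) + 1.15))/(J(|t|) + 0.685 + 0.155 log log|t|)`,
  `J(t) := (1/6) log t + log log t + log 0.618`, stated by Yang as "formed by substituting
  [Hiary–Patel–Yang 2024, Thm. 1.1] into [Ford 2002, Thm. 3]" (Johnston–Yang 2023, Lemma 2.8 is the
  same with `0.77`; "sharpest for `exp(46.3) ≤ t ≤ exp(170.2)`").

Nothing here was in the tree (searched `21.233`, `21.432`, `0.04962` outside the MTY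
intermediate region `zero_free_region_intermediate_mossinghoff_trudgian_yang`, which is MTY's own
Thm. 1.4 `σ > 1 − 0.05035/h + 0.0349/h²`, a different statement). What is deliberately NOT here:
the explicit `k`-th derivative test and `A^{k−2}B` process (Yang §§2–4; parts are in the tree:
`ExplicitAProcess.lean`, `ExplicitKthDerivTest.lean` cite [Yang2024, Lemmas 2.3–2.4]), and the
zero-detector argument of §6.

## References

* A. Yang, J. Math. Anal. Appl. 534 (2024) 128124, Thm. 1.1, Cor. 1.2, eq. (1.4). [Yang2024]
* K. Ford, *Zero-free regions for the Riemann zeta function*, in: Number Theory for the Millennium II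
  (2002), Thm. 3. [Ford2002Millennium]
* G. A. Hiary, D. Patel, A. Yang, J. Number Theory 256 (2024) 195–217, Thm. 1.1. [HiaryPatelYang2024]
* E. C. Titchmarsh, *The Theory of the Riemann Zeta-Function*, 2nd ed., Thm. 5.13, Thm. 5.17
  (Littlewood). [Titchmarsh1986]
-/

noncomputable section

open Complex Real

namespace Literature.NumberTheory.LFunctions

/-! ## The named facts -/

/-- NAMED FACT (Yang 2024, Theorem 1.1, as printed: "Let `k ≥ 4` be an integer and
`σ_k := 1 − k/(2^k − 2)`. Then `|ζ(σ_k + it)| ≤ 1.546 t^{1/(2^k−2)} log t`, `t ≥ 3`"). An explicit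
form of Titchmarsh's Theorem 5.13. `σ_k` and the exponent are written out with `(2:ℝ)^k − 2`.
Unconditional. Users take `(h : zeta_bound_yang)`. [cite: Yang2024, Thm. 1.1] -/
def zeta_bound_yang : Prop :=
  ∀ k : ℕ, 4 ≤ k → ∀ t : ℝ, 3 ≤ t →
    ‖riemannZeta ((1 - (k : ℝ) / ((2 : ℝ) ^ k - 2) : ℝ) + t * I)‖ ≤
      1.546 * t ^ (1 / ((2 : ℝ) ^ k - 2)) * Real.log t

/-- NAMED FACT (Yang 2024, Corollary 1.2, explicit Littlewood zero-free region, as printed: "There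
are no zeroes of `ζ(σ + it)` in the region `σ > 1 − log log|t|/(21.233 log|t|)`, `|t| ≥ 3`").
Unconditional. Users take `(h : zero_free_region_littlewood_yang)`. [cite: Yang2024, Cor. 1.2] -/
def zero_free_region_littlewood_yang : Prop :=
  ∀ σ t : ℝ, 3 ≤ |t| →
    1 - Real.log (Real.log |t|) / (21.233 * Real.log |t|) < σ → riemannZeta (σ + t * I) ≠ 0

/-- Ford's `J`-function with the Hiary–Patel–Yang constant: `J(t) := (1/6) log t + log log t +
log 0.618` (Yang 2024, after (1.4)). [cite: Yang2024, §1.1 (definition of J after (1.4))] -/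
def fordJ (t : ℝ) : ℝ :=
  1 / 6 * Real.log t + Real.log (Real.log t) + Real.log 0.618

/-- NAMED FACT (Yang 2024, display (1.4), as printed: "For intermediate `t`, the following
zero-free region is currently the sharpest known:
`σ > 1 − (0.04962 − 0.0196/(J(|t|) + 1.15))/(J(|t|) + 0.685 + 0.155 log log|t|)`, `|t| ≥ 3`, where
`J(t) := (1/6) log t + log log t + log 0.618`. This is formed by substituting [HPY24, Thm. 1.1] into
[For02b, Thm. 3]"). Ford's Theorem 3 (2002) with the critical-line input `0.618 t^{1/6} log t`;
Johnston–Yang 2023, Lemma 2.8 prints the same region with `0.77`. Unconditional. Users take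
`(h : zero_free_region_ford_hpy)`.
[cite: Yang2024, §1.1 eq. (1.4)] [cite: Ford2002Millennium, Thm. 3] [cite: HiaryPatelYang2024, Thm. 1.1] -/
def zero_free_region_ford_hpy : Prop :=
  ∀ σ t : ℝ, 3 ≤ |t| →
    1 - (0.04962 - 0.0196 / (fordJ |t| + 1.15)) / (fordJ |t| + 0.685 + 0.155 * Real.log (Real.log |t|)) < σ →
      riemannZeta (σ + t * I) ≠ 0

/-! ## Elementary consequences (proved) -/

namespace zeta_bound_yang

/-- The case `k = 4` of Theorem 1.1, as displayed in the source: `|ζ(5/7 + it)| ≤ 1.546 t^{1/14} log t`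
for `t ≥ 3` (`σ₄ = 1 − 4/14 = 5/7`, exponent `1/14`). [cite: Yang2024, Thm. 1.1 (k = 4)] -/
theorem five_sevenths (h : zeta_bound_yang) {t : ℝ} (ht : 3 ≤ t) :
    ‖riemannZeta ((5 / 7 : ℝ) + t * I)‖ ≤ 1.546 * t ^ (1 / 14 : ℝ) * Real.log t := by
  have h4 := h 4 le_rfl t ht
  have e1 : (1 - ((4 : ℕ) : ℝ) / ((2 : ℝ) ^ 4 - 2) : ℝ) = 5 / 7 := by norm_num
  have e2 : (1 / ((2 : ℝ) ^ 4 - 2) : ℝ) = 1 / 14 := by norm_num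
  rw [e1, e2] at h4
  exact h4

/-- The case `k = 5`: `|ζ(5/6 + it)| ≤ 1.546 t^{1/30} log t` for `t ≥ 3` (`σ₅ = 1 − 5/30 = 5/6`).
[cite: Yang2024, Thm. 1.1 (k = 5)] -/
theorem five_sixths (h : zeta_bound_yang) {t : ℝ} (ht : 3 ≤ t) :
    ‖riemannZeta ((5 / 6 : ℝ) + t * I)‖ ≤ 1.546 * t ^ (1 / 30 : ℝ) * Real.log t := by
  have h5 := h 5 (by norm_num) t ht
  have e1 : (1 - ((5 : ℕ) : ℝ) / ((2 : ℝ) ^ 5 - 2) : ℝ) = 5 / 6 := by norm_num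
  have e2 : (1 / ((2 : ℝ) ^ 5 - 2) : ℝ) = 1 / 30 := by norm_num
  rw [e1, e2] at h5
  exact h5

end zeta_bound_yang

namespace zero_free_region_littlewood_yang

/-- Positive-height, non-strict-conclusion reading: a zero `β + it` with `t ≥ 3` satisfies
`β ≤ 1 − log log t/(21.233 log t)`. [cite: Yang2024, Cor. 1.2] -/
theorem re_le_of_zero (h : zero_free_region_littlewood_yang) {β t : ℝ} (ht : 3 ≤ t)
    (hz : riemannZeta (β + t * I) = 0) :
    β ≤ 1 - Real.log (Real.log t) / (21.233 * Real.log t) := by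
  by_contra hlt
  push Not at hlt
  have hta : |t| = t := abs_of_nonneg (by linarith)
  exact h β t (by rw [hta]; exact ht) (by rw [hta]; exact hlt) hz

end zero_free_region_littlewood_yang

namespace zero_free_region_ford_hpy

/-- Positive-height reading: a zero `β + it` with `t ≥ 3` satisfies
`β ≤ 1 − (0.04962 − 0.0196/(J(t) + 1.15))/(J(t) + 0.685 + 0.155 log log t)`.
[cite: Yang2024, §1.1 eq. (1.4)] -/
theorem re_le_of_zero (h : zero_free_region_ford_hpy) {β t : ℝ} (ht : 3 ≤ t)
    (hz : riemannZeta (β + t * I) = 0) :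
    β ≤ 1 - (0.04962 - 0.0196 / (fordJ t + 1.15)) / (fordJ t + 0.685 + 0.155 * Real.log (Real.log t)) := by
  by_contra hlt
  push Not at hlt
  have hta : |t| = t := abs_of_nonneg (by linarith)
  exact h β t (by rw [hta]; exact ht) (by rw [hta]; exact hlt) hz

end zero_free_region_ford_hpy

end Literature.NumberTheory.LFunctions

end
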